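import Summits.PneNP.PneNP.Theses.PlantedClique
import Literature.Probability.RandomGraphs.PlantedCliqueLowDegreeProofs

/-!
# Route PlantedClique — `PlantedcliqueLowDegreeNormOne`, part 1: Fourier coefficients of the
fixed-size planted model (helper for stmt-PneNP-8685)

Port of the Bernoulli computation of `PlantedCliqueLowDegreeProofs` to the FIXED-SIZE planted model
`plantedCliqueDist n k` (planted set uniform among the `min k n`-subsets):
`E χ_T = (-1)^{|T|} · P[V(T) ⊆ S]` with `P[W ⊆ S] = C(n-t, κ-t)/C(n, κ) ≤ (κ/n)^t` (`t = |W|`,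
`κ = min k n`), hence `‖L^{≤D}‖² ≤ Σ_t C(n,t) · cnt(t,D) · ((κ/n)²)^t`, and the deterministic estimate
`Σ_t C(n,t) cnt(t,D) ((κ/n)²)^t ≤ 1/(1 - n^{-ε})` under the regime hypotheses of Hopkins' proof.
-/

set_option linter.dupNamespace false -- `Summit.PneNP.PneNP.…`: summit = sub-problem name (D-0017 single-conjunct layout)

noncomputable section

namespace Summit.PneNP.PneNP.Theorems

open Finset Filter
open Literature.Probability.RandomGraphs Literature.Probability.RandomGraphs.PlantedClique
  Literature.Probability.RandomGraphs.LowDegree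

variable {n : ℕ}

/-- `V⟦T⟧`, the vertex set of a set `T` of edges of `K_n`. Local notation only. [folklore] -/
local notation3 "V⟦" T "⟧" => Finset.biUnion T fun e => Sym2.toFinset (Subtype.val e)

/-- `cnt⟦t, D⟧`: `0` if `t > 2D`, else `min (2^{t²}) ((t²+1)^D)`. Local notation only. [folklore] -/
local notation3 "cnt⟦" t ", " D "⟧" =>
  (if 2 * D < t then 0 else min (2 ^ (t ^ 2)) ((t ^ 2 + 1) ^ D) : ℕ)

/-- `κ(κ-1)⋯(κ-t+1) · n^t ≤ κ^t · n(n-1)⋯(n-t+1)` for `κ ≤ n` (each factor `(κ-i)/(n-i) ≤ κ/n`).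
[folklore] -/
theorem plantedcliqueLowDegree_descFactorial_mul_pow_le {κ n : ℕ} (h : κ ≤ n) :
    ∀ t : ℕ, κ.descFactorial t * n ^ t ≤ κ ^ t * n.descFactorial t
  | 0 => by simp
  | t + 1 => by
    have ih := plantedcliqueLowDegree_descFactorial_mul_pow_le h t
    rw [Nat.descFactorial_succ, Nat.descFactorial_succ, pow_succ, pow_succ]
    have h1 : (κ - t) * n ≤ κ * (n - t) := by
      rcases le_or_gt t κ with ht | ht
      · have htn : t ≤ n := ht.trans h
        zify [ht, htn]
        nlinarith
      · rw [Nat.sub_eq_zero_of_le ht.le, zero_mul]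
        exact Nat.zero_le _
    calc (κ - t) * κ.descFactorial t * (n ^ t * n) = ((κ - t) * n) * (κ.descFactorial t * n ^ t) := by ring
      _ ≤ (κ * (n - t)) * (κ ^ t * n.descFactorial t) := Nat.mul_le_mul h1 ih
      _ = κ ^ t * κ * ((n - t) * n.descFactorial t) := by ring

/-- `C(κ,t) · n^t ≤ κ^t · C(n,t)` for `κ ≤ n`. [folklore] -/
theorem plantedcliqueLowDegree_choose_mul_pow_le {κ n : ℕ} (h : κ ≤ n) (t : ℕ) :
    κ.choose t * n ^ t ≤ κ ^ t * n.choose t := by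
  have h1 := plantedcliqueLowDegree_descFactorial_mul_pow_le h t
  rw [Nat.descFactorial_eq_factorial_mul_choose, Nat.descFactorial_eq_factorial_mul_choose] at h1
  refine Nat.le_of_mul_le_mul_left (?_ : t.factorial * (κ.choose t * n ^ t) ≤ t.factorial * (κ ^ t * n.choose t))
    (Nat.factorial_pos t)
  calc t.factorial * (κ.choose t * n ^ t) = t.factorial * κ.choose t * n ^ t := by ring
    _ ≤ κ ^ t * (t.factorial * n.choose t) := h1
    _ = t.factorial * (κ ^ t * n.choose t) := by ring

/-- **`P[W ⊆ S] ≤ (κ/n)^{|W|}`** for the planted set `S` uniform among the `κ = min k n`-subsets of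
`Fin n` (exactly `C(n-t, κ-t)/C(n,κ) = C(κ,t)/C(n,t)` for `t = |W| ≤ κ`, and `0` for `t > κ`).
[cite: Jerrum1992, §1] [folklore] -/
theorem plantedcliqueLowDegree_superset_prob_le (n k : ℕ) (W : Finset (Fin n)) :
    ∑ S, (PMF.uniformOfFinset (kSubsets n k) (kSubsets_nonempty n k) S).toReal *
        (if W ⊆ S then (1 : ℝ) else 0) ≤ ((((min k n : ℕ) : ℝ) / n) ^ W.card) := by
  set κ : ℕ := min k n with hκ
  have hκn : κ ≤ n := min_le_right _ _
  set s : Finset (Finset (Fin n)) := kSubsets n k with hs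
  have hs' : s = powersetCard κ univ := rfl
  have hscard : s.card = n.choose κ := by rw [hs', card_powersetCard, card_univ, Fintype.card_fin]
  have hspos : (0 : ℝ) < s.card := by
    rw [hscard]
    exact_mod_cast Nat.choose_pos hκn
  -- the probability is `#(s.filter (W ⊆ ·)) / #s`
  have hlhs : ∑ S, (PMF.uniformOfFinset s (kSubsets_nonempty n k) S).toReal *
      (if W ⊆ S then (1 : ℝ) else 0) = ((s.filter (W ⊆ ·)).card : ℝ) / s.card := by
    have hterm : ∀ S : Finset (Fin n), (PMF.uniformOfFinset s (kSubsets_nonempty n k) S).toReal *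
        (if W ⊆ S then (1 : ℝ) else 0) =
          if S ∈ s then (s.card : ℝ)⁻¹ * (if W ⊆ S then (1 : ℝ) else 0) else 0 := by
      intro S
      rw [PMF.uniformOfFinset_apply]
      split_ifs <;> simp [ENNReal.toReal_inv]
    rw [sum_congr rfl fun S _ => hterm S, sum_ite_mem, univ_inter, ← mul_sum, sum_boole,
      div_eq_inv_mul]
  rw [hlhs]
  have hrhs0 : (0 : ℝ) ≤ (((κ : ℕ) : ℝ) / n) ^ W.card := by positivity
  by_cases ht : W.card ≤ κ
  · -- `#(filter) = C(n - t, κ - t)` and `C(n-t,κ-t)/C(n,κ) = C(κ,t)/C(n,t) ≤ (κ/n)^t`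
    have hfil : (s.filter (W ⊆ ·)).card = (n - W.card).choose (κ - W.card) := by
      rw [hs', Finset.card_filter_powersetCard_subset W univ κ (subset_univ W) ht, card_univ,
        Fintype.card_fin]
    rcases Nat.eq_zero_or_pos n with hn0 | hnpos
    · -- `n = 0`: then `W = ∅`, the bound is `1`
      subst hn0
      have hW : W.card = 0 := by
        have := card_le_univ W
        simpa using this
      rw [hW, pow_zero, div_le_one hspos]
      exact_mod_cast card_filter_le _ _
    have hmul : (n.choose κ : ℝ) * (κ.choose W.card) = (n.choose W.card) * ((n - W.card).choose (κ - W.card)) := by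
      exact_mod_cast Nat.choose_mul ht
    have hct : (0 : ℝ) < n.choose W.card := by exact_mod_cast Nat.choose_pos (ht.trans hκn)
    have hnt : (0 : ℝ) < (n : ℝ) ^ W.card := by positivity
    have hch : (κ.choose W.card : ℝ) * (n : ℝ) ^ W.card ≤ (κ : ℝ) ^ W.card * n.choose W.card := by
      exact_mod_cast plantedcliqueLowDegree_choose_mul_pow_le hκn W.card
    rw [hfil, hscard, div_le_iff₀ (by rw [← hscard]; exact hspos)]
    calc (((n - W.card).choose (κ - W.card) : ℕ) : ℝ)
        = (n.choose κ : ℝ) * (κ.choose W.card) / (n.choose W.card) := by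
          rw [eq_div_iff hct.ne', mul_comm _ (n.choose W.card : ℝ), ← hmul]
      _ ≤ (n.choose κ : ℝ) * ((κ : ℝ) ^ W.card / (n : ℝ) ^ W.card) := by
          rw [mul_div_assoc]
          refine mul_le_mul_of_nonneg_left ?_ (Nat.cast_nonneg _)
          rw [div_le_div_iff₀ hct hnt]
          exact hch
      _ = (((κ : ℕ) : ℝ) / n) ^ W.card * (n.choose κ) := by rw [div_pow]; ring
  · -- `t > κ`: no `κ`-subset contains `W`
    have hfil : (s.filter (W ⊆ ·)).card = 0 := by
      rw [card_eq_zero, filter_eq_empty_iff]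
      intro S hS hWS
      have h1 : S.card = κ := (mem_powersetCard.1 (hs' ▸ hS)).2
      have h2 := card_le_card hWS
      omega
    rw [hfil, Nat.cast_zero, zero_div]
    exact hrhs0

/-- **Fourier coefficients of the fixed-size planted model**:
`E_{plantedCliqueDist n k} χ_T = (-1)^{|T|} · P[V(T) ⊆ S]`, `S` uniform among the `min k n`-subsets
(the `G(n,1/2)`-average of `χ_T(plant S x)` vanishes unless all edges of `T` are forced).
[cite: Hopkins2018, Lemma 2.4.1 (proof)] [folklore] -/
theorem plantedcliqueLowDegree_charMean (n k : ℕ) (T : Finset (⊤ : SimpleGraph (Fin n)).edgeSet) :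
    charMean (plantedCliqueDist n k) T = (-1) ^ T.card *
      ∑ S, (PMF.uniformOfFinset (kSubsets n k) (kSubsets_nonempty n k) S).toReal *
        (if V⟦T⟧ ⊆ S then (1 : ℝ) else 0) := by
  have hdist : plantedCliqueDist n k =
      (PMF.uniformOfFinset (kSubsets n k) (kSubsets_nonempty n k)).bind
        fun S => (erdosRenyiHalf n).map (plant S) := by
    rw [plantedCliqueDist, plantedCliqueJoint, PMF.map_bind]
    congr 1
    funext S
    rw [PMF.map_comp]
    rfl
  rw [charMean, hdist, sum_toReal_bind_mul]
  simp_rw [sum_toReal_map_mul, sum_erdosRenyiHalf_walsh_plant, mul_left_comm _ ((-1 : ℝ) ^ T.card),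
    ← mul_sum]

/-- **Grouping by the vertex set**: `‖L^{≤D}‖²(plantedCliqueDist n k) ≤ Σ_t C(n,t) cnt(t,D) ((κ/n)²)^t`,
`κ = min k n`. [cite: Hopkins2018, Lemma 2.4.1 (proof)] -/
theorem plantedcliqueLowDegree_lowDegreeLRSq_le (n k D : ℕ) :
    lowDegreeLRSq (plantedCliqueDist n k) D ≤ ∑ t ∈ range (n + 1), (n.choose t : ℝ) *
      ((cnt⟦t, D⟧ : ℝ) * ((((min k n : ℕ) : ℝ) / n) ^ 2) ^ t) := by
  set x : ℝ := ((((min k n : ℕ) : ℝ) / n) ^ 2) with hx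
  have hT : ∀ T : Finset (⊤ : SimpleGraph (Fin n)).edgeSet,
      charMean (plantedCliqueDist n k) T ^ 2 ≤ x ^ (V⟦T⟧).card := by
    intro T
    rw [plantedcliqueLowDegree_charMean, mul_pow, ← pow_mul, mul_comm T.card 2, pow_mul, neg_one_sq,
      one_pow, one_mul, hx, ← pow_mul, mul_comm 2, pow_mul]
    refine pow_le_pow_left₀ (sum_nonneg fun S _ => mul_nonneg ENNReal.toReal_nonneg ?_)
      (plantedcliqueLowDegree_superset_prob_le n k _) 2
    split_ifs <;> norm_num
  calc lowDegreeLRSq (plantedCliqueDist n k) D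
      ≤ ∑ T ∈ degLE ((⊤ : SimpleGraph (Fin n)).edgeSet) D, x ^ (V⟦T⟧).card :=
        sum_le_sum fun T _ => hT T
    _ ≤ ∑ t ∈ range (n + 1), (n.choose t : ℝ) * ((cnt⟦t, D⟧ : ℝ) * x ^ t) := by
        have h := sum_powerset_apply_card (fun t => (cnt⟦t, D⟧ : ℝ) * x ^ t)
          (x := (univ : Finset (Fin n)))
        simp only [powerset_univ, card_univ, Fintype.card_fin, nsmul_eq_mul] at h
        rw [← h, ← sum_fiberwise (degLE _ D)
          (fun T : Finset (⊤ : SimpleGraph (Fin n)).edgeSet => V⟦T⟧) fun T => x ^ (V⟦T⟧).card]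
        refine sum_le_sum fun W _ => ?_
        rw [sum_congr rfl fun T hT => by rw [(mem_filter.1 hT).2], sum_const, nsmul_eq_mul]
        have hx0 : 0 ≤ x ^ W.card := by positivity
        calc (((degLE ((⊤ : SimpleGraph (Fin n)).edgeSet) D).filter fun T => V⟦T⟧ = W).card : ℝ) * x ^ W.card
            ≤ (cnt⟦W.card, D⟧ : ℝ) * x ^ W.card :=
              mul_le_mul_of_nonneg_right (by exact_mod_cast card_fiber_le D W) hx0
          _ = (fun t => (cnt⟦t, D⟧ : ℝ) * x ^ t) W.card := rfl

/-- **The deterministic estimate** (Hopkins: every term is `n^{-Ω(εt)}`): for `n ≥ 1`, `z = n^ε ≥ 2`,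
`κ ≤ n^{1/2-ε}`, `D ≤ K t` whenever `2^t > z`, and `(4D²+1)^K ≤ z`, the grouped sum is at most the
geometric series `Σ_t z^{-t} ≤ 1/(1 - z⁻¹)`. [cite: Hopkins2018, Lemma 2.4.1 (proof)] -/
theorem plantedcliqueLowDegree_sum_le (n κ D K : ℕ) (ε z : ℝ) (hn : 1 ≤ n) (hz : z = (n : ℝ) ^ ε)
    (hz2 : 2 ≤ z) (hk : (κ : ℝ) ≤ (n : ℝ) ^ (1 / 2 - ε)) (hK : ∀ t : ℕ, z < 2 ^ t → D ≤ K * t)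
    (hpoly : (4 * (D : ℝ) ^ 2 + 1) ^ K ≤ z) :
    ∑ t ∈ range (n + 1), (n.choose t : ℝ) * ((cnt⟦t, D⟧ : ℝ) * (((κ : ℝ) / n) ^ 2) ^ t) ≤
      1 / (1 - z⁻¹) := by
  have hn0 : (0 : ℝ) < n := by exact_mod_cast hn
  have hz0 : 0 < z := by linarith
  set p : ℝ := (κ : ℝ) / n with hp
  set y : ℝ := z⁻¹ with hy
  have hy0 : 0 ≤ y := by positivity
  have hy2 : y ≤ 2⁻¹ := inv_anti₀ two_pos hz2
  have hk2 : (κ : ℝ) ^ 2 ≤ n / z ^ 2 := by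
    have h2 : ((n : ℝ) ^ (1 / 2 : ℝ)) ^ 2 = n := by
      rw [← Real.rpow_mul_natCast hn0.le]
      norm_num
    calc (κ : ℝ) ^ 2 ≤ ((n : ℝ) ^ (1 / 2 - ε)) ^ 2 := pow_le_pow_left₀ (Nat.cast_nonneg _) hk 2
      _ = n / z ^ 2 := by rw [hz, Real.rpow_sub hn0, div_pow, h2]
  have hnx : (n : ℝ) * p ^ 2 ≤ y ^ 2 :=
    calc (n : ℝ) * p ^ 2 = (κ : ℝ) ^ 2 / n := by rw [hp]; field_simp
      _ ≤ n / z ^ 2 / n := by gcongr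
      _ = y ^ 2 := by rw [hy, inv_pow]; field_simp
  have hterm : ∀ t ∈ range (n + 1),
      (n.choose t : ℝ) * ((cnt⟦t, D⟧ : ℝ) * (p ^ 2) ^ t) ≤ y ^ t := by
    intro t _
    have hc : (cnt⟦t, D⟧ : ℝ) ≤ z ^ t := cnt_le_pow t D K z (by linarith) hK hpoly
    calc (n.choose t : ℝ) * ((cnt⟦t, D⟧ : ℝ) * (p ^ 2) ^ t)
        ≤ (n : ℝ) ^ t * ((cnt⟦t, D⟧ : ℝ) * (p ^ 2) ^ t) := by
          gcongr
          exact_mod_cast Nat.choose_le_pow n t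
      _ = (cnt⟦t, D⟧ : ℝ) * ((n : ℝ) * p ^ 2) ^ t := by rw [mul_pow]; ring
      _ ≤ z ^ t * (y ^ 2) ^ t :=
          mul_le_mul hc (pow_le_pow_left₀ (by positivity) hnx t) (by positivity) (by positivity)
      _ = (y * z) ^ t * y ^ t := by ring
      _ = y ^ t := by rw [hy, inv_mul_cancel₀ hz0.ne', one_pow, one_mul]
  calc ∑ t ∈ range (n + 1), (n.choose t : ℝ) * ((cnt⟦t, D⟧ : ℝ) * (p ^ 2) ^ t)
      ≤ ∑ t ∈ range (n + 1), y ^ t := sum_le_sum hterm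
    _ ≤ y ^ 0 / (1 - y) := by
        rw [range_eq_Ico]
        exact geom_sum_Ico_le_of_lt_one hy0 (by linarith)
    _ = 1 / (1 - z⁻¹) := by rw [pow_zero]

end Summit.PneNP.PneNP.Theorems

end
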